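import Mathlib
import Summits.KontsevichZagierPeriods.Zeta5Search.Families.RayGrowth
import Summits.KontsevichZagierPeriods.Zeta5Search.Families.IntegrabilityApplications
import HarnessLib

/-!
# ζ(5) search — Families: the growth constant of the Brown–Zudilin `₈π₈^∨` family in every convergent direction

HONEST FRAMING: systematic search; no irrationality claim unless certified.  STRUCTURAL facts about the SIZE of the
Brown–Zudilin cellular integrals `I(a) = ∫ f ω` of [BrownZudilin2022, §1 (1)] (`BrownZudilin2022.cellularIntegral`,
the Literature object) along the rays `a = N·a⁰`, `N ∈ ℕ`, for EVERY direction `a⁰ ∈ ℤ⁸` satisfying the seventeen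
linear forms (3) (`BrownZudilin2022.Converges a⁰`) — in particular the Theorem-1 direction `(8,16,10,15,12,16,18,13)`
of the `ζ(5)` record and Zudilin's totally symmetric direction `(1,…,1)`.  Nothing here is arithmetic: no linear
forms in zeta values, no denominators, no `γ`.  Seat P2, Families layer; instance of `Families/RayGrowth.lean`.

* `bzNum_smul`, `bzDen_smul`, `converges_smul`, `brownConvergent_bz_ray` — the BZ parametrisation is linear and the
  cone (3) is a cone, so the whole ray `N·a⁰` lies in Brown's convergence region;
* **`bzSup a⁰ := M_{₈π₈^∨}(a⁰) = sup_S f_σ(bzNum a⁰, bzDen a⁰)`** — the growth constant BY NAME, `0 < bzSup a⁰`;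
* **`tendsto_cellularIntegral_root`** — `I(N·a⁰)^{1/N} → bzSup a⁰`; `cellularIntegral_le_bzSup_pow`
  (`I(N·a⁰) ≤ bzSup^N · I(0)`); `cellularIntegral_ratio_mono`, **`cellularIntegral_ratio_le_bzSup`** (every exactly
  computed ratio `I((N+1)a⁰)/I(Na⁰)` is a CERTIFIED LOWER BOUND for the growth constant),
  **`tendsto_cellularIntegral_ratio`** (`I((N+1)a⁰)/I(Na⁰) ↑ bzSup a⁰`);
* `raySup_one_one` — on the basic ray the constant is the `fSup` of `Families/BasicGrowth.lean`;
* the Theorem-1 direction: `tendsto_thm1_root`, `thm1_ratio_le_bzSup`.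
Standard axioms only.
-/

noncomputable section

open MeasureTheory Set Finset Filter Topology

namespace Summit.KontsevichZagierPeriods.Zeta5Search.Families.Cellular

open Literature.NumberTheory.Irrationality

/-! ### The Brown–Zudilin parametrisation is linear; the cone (3) is a cone -/

/-- `bzNum (N·a) = N · bzNum a`. -/
theorem bzNum_smul (N : ℤ) (a : Fin 8 → ℤ) : bzNum (fun i => N * a i) = fun i => N * bzNum a i := by
  ext i
  fin_cases i <;> simp [bzNum]
  ring

/-- `bzDen (N·a) = N · bzDen a`. -/
theorem bzDen_smul (N : ℤ) (a : Fin 8 → ℤ) : bzDen (fun i => N * a i) = fun i => N * bzDen a i := by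
  ext i
  fin_cases i <;> simp [bzDen, BrownZudilin2022.b24, BrownZudilin2022.b14, BrownZudilin2022.b57,
    BrownZudilin2022.b35, BrownZudilin2022.b36] <;> ring

/-- The seventeen linear forms (3) define a CONE: `Converges a → Converges (N·a)` for `N ≥ 0`. [BrownZudilin2022, (3)] -/
theorem converges_smul {a : Fin 8 → ℤ} (h : BrownZudilin2022.Converges a) {N : ℤ} (hN : 0 ≤ N) :
    BrownZudilin2022.Converges (fun i => N * a i) := by
  rw [converges_iff] at h ⊢
  obtain ⟨h0, h1, h2, h3, h4, h5, h6, h7, h8, h9, h10, h11, h12, h13, h14, h15, h16⟩ := h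
  refine ⟨mul_nonneg hN h0, mul_nonneg hN h1, mul_nonneg hN h2, mul_nonneg hN h3, mul_nonneg hN h4,
    mul_nonneg hN h5, mul_nonneg hN h6, ?_, ?_, ?_, ?_, ?_, ?_, ?_, ?_, ?_, ?_⟩
  · nlinarith [mul_nonneg hN h7]
  · nlinarith [mul_nonneg hN h8]
  · nlinarith [mul_nonneg hN h9]
  · nlinarith [mul_nonneg hN h10]
  · nlinarith [mul_nonneg hN h11]
  · nlinarith [mul_nonneg hN h12]
  · nlinarith [mul_nonneg hN h13]
  · nlinarith [mul_nonneg hN h14]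
  · nlinarith [mul_nonneg hN h15]
  · nlinarith [mul_nonneg hN h16]

/-- The whole ray `N ↦ (N·bzNum a, N·bzDen a)`, `N ≥ 0`, lies in Brown's convergence region when `a` satisfies (3). -/
theorem brownConvergent_bz_ray {a : Fin 8 → ℤ} (h : BrownZudilin2022.Converges a) (N : ℤ) (hN : 0 ≤ N) :
    BrownConvergent pi8dual (fun i => N * bzNum a i) (fun i => N * bzDen a i) := by
  rw [← bzNum_smul, ← bzDen_smul, brownConvergent_bz_iff]
  exact converges_smul h hN

/-- The Brown–Zudilin integral at `N·a` is the generalised cellular integral of `₈π₈^∨` at the ray point `N`. -/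
theorem cellularIntegral_smul_eq (a : Fin 8 → ℤ) (N : ℕ) :
    BrownZudilin2022.cellularIntegral (fun i => (N : ℤ) * a i) =
      integral pi8dual (fun i => (N : ℤ) * bzNum a i) (fun i => (N : ℤ) * bzDen a i) := by
  rw [← integral_bz, bzNum_smul, bzDen_smul]

/-! ### The growth constant of the family in direction `a` -/

/-- **The growth constant of the Brown–Zudilin family in direction `a ∈ ℤ⁸`**:
`bzSup a = sup_S f_{₈π₈^∨}(bzNum a, bzDen a)`. [structural; BrownZudilin2022 (1) objects] -/
def bzSup (a : Fin 8 → ℤ) : ℝ := raySup pi8dual (bzNum a) (bzDen a)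

/-- `0 < bzSup a` for every direction in the cone (3). -/
theorem bzSup_pos {a : Fin 8 → ℤ} (h : BrownZudilin2022.Converges a) : 0 < bzSup a :=
  raySup_pos pi8dual (bzNum a) (bzDen a) pi8dual_bijective (homogeneous_bz a) (brownConvergent_bz_ray h)

/-- **`I(N·a)^{1/N} → bzSup a`** for every direction `a` in the cone (3). -/
theorem tendsto_cellularIntegral_root {a : Fin 8 → ℤ} (h : BrownZudilin2022.Converges a) :
    Tendsto (fun N : ℕ => (BrownZudilin2022.cellularIntegral (fun i => (N : ℤ) * a i)) ^ (1 / (N : ℝ))) atTop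
      (𝓝 (bzSup a)) := by
  simp only [cellularIntegral_smul_eq]
  exact tendsto_integral_ray_root pi8dual (bzNum a) (bzDen a) pi8dual_bijective (homogeneous_bz a)
    (brownConvergent_bz_ray h)

/-- `(log I(N·a))/N → log (bzSup a)`. -/
theorem tendsto_log_cellularIntegral_div {a : Fin 8 → ℤ} (h : BrownZudilin2022.Converges a) :
    Tendsto (fun N : ℕ => Real.log (BrownZudilin2022.cellularIntegral (fun i => (N : ℤ) * a i)) / N) atTop
      (𝓝 (Real.log (bzSup a))) := by
  simp only [cellularIntegral_smul_eq]
  exact tendsto_log_integral_ray_div pi8dual (bzNum a) (bzDen a) pi8dual_bijective (homogeneous_bz a)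
    (brownConvergent_bz_ray h)

/-- `I(N·a) ≤ (bzSup a)^N · I(0)`. -/
theorem cellularIntegral_le_bzSup_pow {a : Fin 8 → ℤ} (h : BrownZudilin2022.Converges a) (N : ℕ) :
    BrownZudilin2022.cellularIntegral (fun i => (N : ℤ) * a i) ≤
      bzSup a ^ N * BrownZudilin2022.cellularIntegral (fun i => ((0 : ℕ) : ℤ) * a i) := by
  rw [cellularIntegral_smul_eq, cellularIntegral_smul_eq]
  exact integral_ray_le_raySup_pow pi8dual (bzNum a) (bzDen a) pi8dual_bijective (homogeneous_bz a)
    (brownConvergent_bz_ray h) N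

/-- Log-convexity: `I((N+1)a)² ≤ I(Na) · I((N+2)a)`. -/
theorem cellularIntegral_sq_le_mul {a : Fin 8 → ℤ} (h : BrownZudilin2022.Converges a) (N : ℕ) :
    BrownZudilin2022.cellularIntegral (fun i => ((N + 1 : ℕ) : ℤ) * a i) ^ 2 ≤
      BrownZudilin2022.cellularIntegral (fun i => (N : ℤ) * a i) *
        BrownZudilin2022.cellularIntegral (fun i => ((N + 2 : ℕ) : ℤ) * a i) := by
  rw [cellularIntegral_smul_eq, cellularIntegral_smul_eq, cellularIntegral_smul_eq]
  exact integral_ray_sq_le_mul pi8dual (bzNum a) (bzDen a) pi8dual_bijective (homogeneous_bz a)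
    (brownConvergent_bz_ray h) N

/-- The ratios `I((N+1)a)/I(Na)` are non-decreasing. -/
theorem cellularIntegral_ratio_mono {a : Fin 8 → ℤ} (h : BrownZudilin2022.Converges a) :
    Monotone fun N : ℕ => BrownZudilin2022.cellularIntegral (fun i => ((N + 1 : ℕ) : ℤ) * a i) /
      BrownZudilin2022.cellularIntegral (fun i => (N : ℤ) * a i) := by
  simp only [cellularIntegral_smul_eq]
  exact integral_ray_ratio_mono pi8dual (bzNum a) (bzDen a) pi8dual_bijective (homogeneous_bz a)
    (brownConvergent_bz_ray h)

/-- **Every ratio `I((N+1)a)/I(Na)` is a lower bound for the growth constant `bzSup a`.** -/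
theorem cellularIntegral_ratio_le_bzSup {a : Fin 8 → ℤ} (h : BrownZudilin2022.Converges a) (N : ℕ) :
    BrownZudilin2022.cellularIntegral (fun i => ((N + 1 : ℕ) : ℤ) * a i) /
      BrownZudilin2022.cellularIntegral (fun i => (N : ℤ) * a i) ≤ bzSup a := by
  rw [cellularIntegral_smul_eq, cellularIntegral_smul_eq]
  exact integral_ray_ratio_le_raySup pi8dual (bzNum a) (bzDen a) pi8dual_bijective (homogeneous_bz a)
    (brownConvergent_bz_ray h) N

/-- **The ratio limit**: `I((N+1)a)/I(Na) → bzSup a`. -/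
theorem tendsto_cellularIntegral_ratio {a : Fin 8 → ℤ} (h : BrownZudilin2022.Converges a) :
    Tendsto (fun N : ℕ => BrownZudilin2022.cellularIntegral (fun i => ((N + 1 : ℕ) : ℤ) * a i) /
      BrownZudilin2022.cellularIntegral (fun i => (N : ℤ) * a i)) atTop (𝓝 (bzSup a)) := by
  simp only [cellularIntegral_smul_eq]
  exact tendsto_integral_ray_ratio pi8dual (bzNum a) (bzDen a) pi8dual_bijective (homogeneous_bz a)
    (brownConvergent_bz_ray h)

/-! ### The basic ray and the Theorem-1 direction -/

/-- On the basic ray `α = β = 1` the ray function is Brown's `f_σ`. -/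
theorem rayF_one_one {ℓ : ℕ} (σ : Fin (ℓ + 3) → Fin (ℓ + 3)) :
    rayF σ (fun _ => (1 : ℤ)) (fun _ => (1 : ℤ)) = fSigma σ := by
  funext t
  simp [rayF, fSigma, num, den, formDen]

/-- On the basic ray the growth constant of `Families/RayGrowth.lean` is the `fSup` of `Families/BasicGrowth.lean`. -/
theorem raySup_one_one {ℓ : ℕ} (σ : Fin (ℓ + 3) → Fin (ℓ + 3)) :
    raySup σ (fun _ => (1 : ℤ)) (fun _ => (1 : ℤ)) = fSup σ := by
  rw [raySup, rayF_one_one, fSup]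

/-- For `₈π₈^∨`: `bzSup (1,…,1) = fSup pi8dual` (Zudilin's totally symmetric direction is the basic ray). -/
theorem bzSup_one : bzSup (fun _ => (1 : ℤ)) = fSup pi8dual := by
  rw [bzSup, bzNum_const, bzDen_const, raySup_one_one]

/-- The Theorem-1 direction of [BrownZudilin2022]: `I(N·(8,16,10,15,12,16,18,13))^{1/N} → bzSup (8,16,10,15,12,16,18,13)`
(the SIZE constant of the record family by name; its value is not computed here). [BrownZudilin2022, Thm 1 (direction)] -/
theorem tendsto_thm1_root :
    Tendsto (fun N : ℕ => (BrownZudilin2022.cellularIntegral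
      (fun i => (N : ℤ) * (![8, 16, 10, 15, 12, 16, 18, 13] : Fin 8 → ℤ) i)) ^ (1 / (N : ℝ))) atTop
      (𝓝 (bzSup ![8, 16, 10, 15, 12, 16, 18, 13])) :=
  tendsto_cellularIntegral_root BrownZudilin2022.converges_thm1_vector

/-- In the Theorem-1 direction every ratio of consecutive integrals bounds the growth constant from below. -/
theorem thm1_ratio_le_bzSup (N : ℕ) :
    BrownZudilin2022.cellularIntegral (fun i => ((N + 1 : ℕ) : ℤ) * (![8, 16, 10, 15, 12, 16, 18, 13] : Fin 8 → ℤ) i) /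
      BrownZudilin2022.cellularIntegral (fun i => (N : ℤ) * (![8, 16, 10, 15, 12, 16, 18, 13] : Fin 8 → ℤ) i) ≤
      bzSup ![8, 16, 10, 15, 12, 16, 18, 13] :=
  cellularIntegral_ratio_le_bzSup BrownZudilin2022.converges_thm1_vector N

end Summit.KontsevichZagierPeriods.Zeta5Search.Families.Cellular
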